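/-
Copyright (c) 2026 the pub-hodgecm-mathlib formalisation cell (harness21).  Prover seat hodgecm-mathlib-LH4-p14 (g2), req620 Track A «(D-RAM) FOUR-FRAME» squad
(unit U3_Laws, MS ROAD A Stage A; brick (O2b) «FIBRE COUNT ALONG A UNIT-TORUS ORBIT», LH4-p11 (g0) cut 2026-09-03T23:33:55Z, dealt by LH4-p10 (g2) round 2;
MS first seat LH4-p11 (g0), Stage B lead LH4-p10 (g2), dealer LH4-plan (g11)).  2026-09-04.
-/
import Summits.HodgeConjecture.HodgeConjecture.Theorems.F0P3cDyRamDiagonalOrbitFibreTransport    -- (O2b) PART 2 (this seat): transport, norm classes, type-0 coset; brings ★ TorusDefs, K, (3b), J′, M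
import Summits.HodgeConjecture.HodgeConjecture.Theorems.F0P3cDyRamTorusRepresentativesCount      -- (O2b) PART 1 (this seat): representatives-in-a-coset count, the index identity
import Summits.HodgeConjecture.HodgeConjecture.Theorems.F0P3cDyRamDiagonalPairReindex            -- ★ (O2a) p855745 (LH4-p04 (g2)): `ncard_setOf_mem_and_mem_eq_finsum_mem`, `ncard_setOf_mem_eq_sum`
import Mathlib.Tactic.LinearCombination
import Mathlib.Tactic.FieldSimp
import HarnessLib

/-!
# Crux `H413`, line LH4 «(D-RAM) FOUR-FRAME» road — unit U3_Laws (iii), MS ROAD A Stage A, brick (O2b): THE FIBRE COUNT ALONG A UNIT-TORUS ORBIT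
# `(Σ_{M ∈ 𝒯·M₀} #{(e, a) : diag(ϖ^{a})·M is a type-tv vertex of diag(c^{e})}) · [𝒰 : S_F(M₀)] = 8 · [𝒯 : S̃(M₀)] · [M₀ has a σ-fixed diagonal type-tv form]`

Cell `hodgecm-mathlib` (D-0151), FLOOR 0, crux item H413 = `stmt-HodgeConjecture-24833`, route of record `HCCMUnconditional`; squad F0∕P3c∕LH4 (req618∕req620).  THEOREMS ONLY
(no `def`, no instance, no notation, no `sorry`); lane `--supports stmt-HodgeConjecture-24833 --as helper` (count-neutral).  Statement = LH4-p11 (g0)'s (O2b) cut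
(2026-09-03T23:33:55Z) «multiplied through», the type-tv «one `S_F`-coset» input as the hypothesis `hcoset` (discharged here at `tv = 0` by PART 2 `fibre_isCoset_zero`; at
`tv = 2` it is LH4-p10 (g2)'s B9-0), the Iverson bracket split into a positive head (`∃ D₁`) and a vanishing head (`¬ ∃ D₁`).  ROUTE = LH4-p10 MEMO-stableLaw-finite v1 §2 (3)(b)(c)(d):
(1) along `M = diag(u)·M₀` the fibre is `{(e, a) : c^{e}·N(ϖu^{a}u) ∈ Φ}`, `Φ = {D : M₀ type-tv for diag D}` (PART 2 transport); (2) `Φ = D₁·S_F` (`hcoset`), `D₁ = N(ϖu^{a₀})·w`, `w ∈ 𝒰`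
(PART 2 decomposition), so `a = a₀` is pinned and the fibre is `{e : c^{e}·N(u)·w⁻¹ ∈ S_F}`; (3) summing over the orbit and swapping the order, for each `e` the lattices counted form
ONE translate of the `H`-orbit of `M₀`, `H = 𝒯 ∩ N⁻¹(S_F)` (size `[H : S̃]`, PART 2 §1), present iff `w⁻¹c^{e} ∈ N(𝒯)·S_F` — `[N𝒯·S_F : N𝒯]` of the eight `e` (PART 1
`card_filter_mem_coset_eq_relIndex`, the `c^{e}` representing `𝒰 ∕ N𝒯` by ★ M); (4) PART 1's index identity turns `[N𝒯·S_F : N𝒯]·[H : S̃]·[𝒰 : S_F]` into `[𝒰 : N𝒯]·[𝒯 : S̃] =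
8·[𝒯 : S̃]`.
* `finsum_ncard_fibre_mul_relIndex_eq_of_exists` — the positive head (any `M₀` with finite `𝒯`-orbit, `hcoset`);  `finsum_ncard_fibre_eq_zero_of_not_exists` — the vanishing head.
  PART 4 (`…OrbitFibreCountHeads`): the Iverson form, `tv = 0` with `hcoset` discharged, and the heads in `𝓛₀(T)`-currency.
HONEST LABEL.  Count-neutral (`--supports`); nothing printed is asserted; (MS) stays a PROVER TARGET; `HC_CM` is proved only modulo the 7 printed citations (2 remaining named inputs:
hLiu418 = `stmt-HodgeConjecture-24832`, h413 = `stmt-HodgeConjecture-24833`) until rung 0 closes.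

## References
* [Kottwitz1986BaseChangeUnits] R. E. Kottwitz, *Base change for unit elements of Hecke algebras*, Compositio Math. 60 (1986), §1 pp. 240–241.
* [Rogawski1990] J. D. Rogawski, *Automorphic Representations of Unitary Groups in Three Variables*, Ann. of Math. Stud. 123 (1990), §4.9 Prop. 4.9.1 (a) p. 55.
* [Serre1979] J.-P. Serre, *Local Fields*, GTM 67 (1979), Ch. V §3.
-/

set_option autoImplicit false

noncomputable section

namespace Summit.HodgeConjecture.HodgeConjecture.Cruxes.H413.F0P3cDyRamDiagonalOrbitFibreCount

open Matrix
open Literature.NumberTheory.Automorphic Literature.NumberTheory.Automorphic.HermitianLattice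
open Literature.NumberTheory.Automorphic.UnitaryLatticeTree
open Summit.HodgeConjecture.HodgeConjecture.Cruxes.H413.F0P3cDyRamDiagonalTorusDefs
open Summit.HodgeConjecture.HodgeConjecture.Cruxes.H413.F0P3cDyRamDiagonalOrbitFibreTransport
open Summit.HodgeConjecture.HodgeConjecture.Cruxes.H413.F0P3cDyRamTorusRepresentativesCount
open Summit.HodgeConjecture.HodgeConjecture.Cruxes.H413.F0P3cDyRamDiagonalPairReindex
open scoped Valued WithZero Matrix MatrixGroups

variable {K : Type*} [Field K] [Valued K ℤᵐ⁰]

/-! ## §1  Two small facts about the norm map on `ϖu`-powers and on units -/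

/-- `|N(ϖu^{a})_i| = exp(−2 a_i)` (`|ϖ| = exp(−1)`, `σ` isometric). [cite: Serre1979, Ch. V §3] -/
theorem v_unitNormMap_zpow {σ : K →+* K} (hvσ : ∀ a, Valued.v (σ a) = Valued.v a) {ϖ : K} (hϖ : Valued.v ϖ = WithZero.exp (-1 : ℤ))
    (ϖu : Kˣ) (hϖu : (ϖu : K) = ϖ) (a : Fin 3 → ℤ) (i : Fin 3) :
    Valued.v ((unitNormMap σ 3 (fun j => ϖu ^ a j) i : Kˣ) : K) = WithZero.exp (-(2 * a i)) := by
  rw [unitNormMap_apply, map_mul, hvσ, Units.val_zpow_eq_zpow_val, map_zpow₀, hϖu, hϖ, ← WithZero.exp_zsmul, ← WithZero.exp_add]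
  congr 1
  simp only [smul_eq_mul]
  ring

/-- `|N(u)_i| = 1` for `u ∈ 𝒯`. [cite: Serre1979, Ch. V §3] -/
theorem v_unitNormMap_of_mem_unitTorus {σ : K →+* K} (hvσ : ∀ a, Valued.v (σ a) = Valued.v a) {u : Fin 3 → Kˣ} (hu : u ∈ unitTorus K 3) (i : Fin 3) :
    Valued.v ((unitNormMap σ 3 u i : Kˣ) : K) = 1 := by
  rw [unitNormMap_apply, map_mul, hvσ, (mem_unitTorus_iff u).1 hu i, mul_one]

/-! ## §2  The positive head -/

/-- **(O2b) FIBRE COUNT ALONG A UNIT-TORUS ORBIT — POSITIVE HEAD.**  `σ` an isometric involution, `|ϖ| = exp(−1)` with unit avatar `ϖu`, `c` a `σ`-fixed NON-NORM unit with the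
(NI2) dichotomy, ANY `𝒪`-submodule `M₀` with FINITE unit-torus orbit, `tv` any type for which the fibre `{D : M₀ type-tv for diag D}` over `M₀` is one `S_F(M₀)`-coset (`hcoset`),
and SOME `σ`-fixed non-degenerate `diag(D₁)` of type `tv` at `M₀`.  Then
`(Σᶠ_{M ∈ 𝒯·M₀} #{(e, a) : diag(ϖu^{a})·M is a type-tv vertex of diag(d_e)}) · [𝒰 : S_F(M₀)] = 8 · [𝒯 : S̃(M₀)]` (`d_e i = c` if `e i` else `1`).
[cite: Kottwitz1986BaseChangeUnits, §1 pp. 240–241] [cite: Rogawski1990, §4.9 Prop. 4.9.1 (a) p. 55] -/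
theorem finsum_ncard_fibre_mul_relIndex_eq_of_exists {σ : K →+* K} (hσ : ∀ x, σ (σ x) = x) (hvσ : ∀ a, Valued.v (σ a) = Valued.v a)
    {ϖ : K} (hϖ : Valued.v ϖ = WithZero.exp (-1 : ℤ)) (ϖu : Kˣ) (hϖu : (ϖu : K) = ϖ)
    {c : K} (hσc : σ c = c) (hcv : Valued.v c = 1) (hc : ¬ ∃ z : K, z * σ z = c)
    (hdich : ∀ x : K, σ x = x → x ≠ 0 → (∃ z : K, z * σ z = x) ∨ ∃ z : K, z * σ z = c * x)
    {M₀ : Submodule 𝒪[K] (Fin 3 → K)}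
    (hfin : {M : Submodule 𝒪[K] (Fin 3 → K) | ∃ u ∈ unitTorus K 3, M = mapGL (diagGLUnits u) M₀}.Finite) (tv : ℕ)
    (hcoset : ∀ D₁ : Fin 3 → K, (∀ i, σ (D₁ i) = D₁ i ∧ D₁ i ≠ 0) → IsVertexLattice σ ϖ (Matrix.diagonal D₁) tv M₀ →
      ∀ D : Fin 3 → K, (∀ i, σ (D i) = D i ∧ D i ≠ 0) →
        (IsVertexLattice σ ϖ (Matrix.diagonal D) tv M₀ ↔ ∃ u ∈ fixedUnitStabilizer σ M₀, ∀ i, D i = D₁ i * (u i : Kˣ)))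
    (hex : ∃ D₁ : Fin 3 → K, (∀ i, σ (D₁ i) = D₁ i ∧ D₁ i ≠ 0) ∧ IsVertexLattice σ ϖ (Matrix.diagonal D₁) tv M₀) :
    (∑ᶠ M ∈ {M : Submodule 𝒪[K] (Fin 3 → K) | ∃ u ∈ unitTorus K 3, M = mapGL (diagGLUnits u) M₀},
        ({p : (Fin 3 → Bool) × (Fin 3 → ℤ) |
          IsVertexLattice σ ϖ (Matrix.diagonal fun i => if p.1 i then c else (1 : K)) tv (mapGL (diagGLUnits fun i => ϖu ^ p.2 i) M)} : Set _).ncard)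
      * (fixedUnitStabilizer σ M₀).relIndex (fixedUnitTorus σ 3) = 8 * (unitStabilizer M₀).relIndex (unitTorus K 3) := by
  classical
  have hc0 : c ≠ 0 := fun h => by simp [h] at hcv
  obtain ⟨D₁, hD₁, hV₁⟩ := hex
  -- coordinatewise check of identities in `(K^×)³`
  have upi : ∀ {x y : Fin 3 → Kˣ}, (∀ i, ((x i : Kˣ) : K) = y i) → x = y := fun h => funext fun i => Units.ext (h i)
  set cU : Kˣ := Units.mk0 c hc0 with hcUdef
  have hcU : (cU : K) = c := rfl
  set cvec : (Fin 3 → Bool) → (Fin 3 → Kˣ) := fun e i => if e i then cU else 1 with hcvec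
  have hcvec_val : ∀ e i, ((cvec e i : Kˣ) : K) = if e i then c else 1 := by
    intro e i; by_cases h : e i <;> simp [hcvec, h, hcU]
  have hcvec_ne : ∀ (e : Fin 3 → Bool) i, (if e i then c else (1 : K)) ≠ 0 := by
    intro e i; by_cases h : e i <;> simp [h, hc0]
  have hcvec_v : ∀ (e : Fin 3 → Bool) i, Valued.v (if e i then c else (1 : K)) = 1 := by
    intro e i; by_cases h : e i <;> simp [h, hcv]
  have hcvec_fix : ∀ (e : Fin 3 → Bool) i, σ (if e i then c else (1 : K)) = if e i then c else 1 := by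
    intro e i; by_cases h : e i <;> simp [h, hσc]
  have hcvecU : ∀ e, cvec e ∈ fixedUnitTorus σ 3 := by
    intro e
    rw [mem_fixedUnitTorus_iff]
    exact ⟨fun i => by rw [hcvec_val]; exact hcvec_v e i, fun i => by rw [hcvec_val]; exact hcvec_fix e i⟩
  have hUT : fixedUnitTorus σ 3 ≤ unitTorus K 3 := fun x hx => ((mem_fixedUnitTorus_iff σ x).1 hx).1
  have hNT : (unitTorus K 3).map (unitNormMap σ 3) ≤ fixedUnitTorus σ 3 := map_unitNormMap_unitTorus_le hσ hvσ
  -- the decomposition `D₁ = N(ϖu^{a₀}) · w`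
  obtain ⟨a₀, w, hwU, hD₁w⟩ := exists_zpow_fixedUnit_decomposition hσ hvσ hϖ ϖu hϖu hσc hcv hdich D₁ hD₁
  have hwU' := (mem_fixedUnitTorus_iff σ w).1 hwU
  -- Step 1: `N(S̃) ≤ S_F`
  have hNS : (latticeStabilizer M₀ ⊓ unitTorus K 3).map (unitNormMap σ 3) ≤ latticeStabilizer M₀ ⊓ fixedUnitTorus σ 3 := by
    rintro _ ⟨s, hs, rfl⟩
    have hs' := Subgroup.mem_inf.1 hs
    have hsS : mapGL (diagGLUnits s) M₀ = M₀ := (mem_latticeStabilizer_iff M₀ s).1 hs'.1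
    have hV' : IsVertexLattice σ ϖ (Matrix.diagonal D₁) tv (mapGL (diagGLUnits s) M₀) := by rw [hsS]; exact hV₁
    rw [isVertexLattice_diagonal_mapGL_diagGLUnits_iff] at hV'
    have hDfix : ∀ i, σ (D₁ i * ((s i : K) * σ (s i))) = D₁ i * ((s i : K) * σ (s i)) ∧ D₁ i * ((s i : K) * σ (s i)) ≠ 0 := fun i =>
      ⟨by rw [map_mul, map_mul, (hD₁ i).1, hσ, mul_comm (σ (s i : K))],
        mul_ne_zero (hD₁ i).2 (mul_ne_zero (s i).ne_zero ((map_ne_zero σ).2 (s i).ne_zero))⟩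
    obtain ⟨u, huSF, hu⟩ := (hcoset D₁ hD₁ hV₁ _ hDfix).1 hV'
    have heq : unitNormMap σ 3 s = u := upi fun i => by
      rw [unitNormMap_apply]; exact mul_left_cancel₀ (hD₁ i).2 (hu i)
    rw [heq]; exact huSF
  -- Step 2: the fibre along `diag(u)·M₀`: `(e, a)` is in it iff `a = a₀` and `c^e·N(u)·w⁻¹ ∈ S_F`
  have step2 : ∀ u ∈ unitTorus K 3, ∀ (e : Fin 3 → Bool) (a : Fin 3 → ℤ),
      IsVertexLattice σ ϖ (Matrix.diagonal fun i => if e i then c else (1 : K)) tv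
          (mapGL (diagGLUnits fun i => ϖu ^ a i) (mapGL (diagGLUnits u) M₀)) ↔
        a = a₀ ∧ cvec e * unitNormMap σ 3 u * w⁻¹ ∈ fixedUnitStabilizer σ M₀ := by
    intro u hu e a
    rw [← mapGL_mul, ← map_mul, isVertexLattice_diagonal_mapGL_diagGLUnits_iff]
    have hDfix : ∀ i, σ ((if e i then c else (1 : K)) * ((((fun j => ϖu ^ a j) * u) i : Kˣ) * σ (((fun j => ϖu ^ a j) * u) i : Kˣ)))
        = (if e i then c else (1 : K)) * ((((fun j => ϖu ^ a j) * u) i : Kˣ) * σ (((fun j => ϖu ^ a j) * u) i : Kˣ)) ∧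
        (if e i then c else (1 : K)) * ((((fun j => ϖu ^ a j) * u) i : Kˣ) * σ (((fun j => ϖu ^ a j) * u) i : Kˣ)) ≠ 0 := fun i =>
      ⟨by rw [map_mul, map_mul, hcvec_fix, hσ, mul_comm (σ _) (_ : K)],
        mul_ne_zero (hcvec_ne e i) (mul_ne_zero (Units.ne_zero _) ((map_ne_zero σ).2 (Units.ne_zero _)))⟩
    rw [hcoset D₁ hD₁ hV₁ _ hDfix]
    -- translate the coordinate equations to ONE equation in the unit group
    have key : ∀ s : Fin 3 → Kˣ, (∀ i, (if e i then c else (1 : K)) * ((((fun j => ϖu ^ a j) * u) i : Kˣ) * σ (((fun j => ϖu ^ a j) * u) i : Kˣ))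
          = D₁ i * (s i : Kˣ)) ↔
        unitNormMap σ 3 (fun j => ϖu ^ a j) * (cvec e * unitNormMap σ 3 u) = unitNormMap σ 3 (fun j => ϖu ^ a₀ j) * (w * s) := by
      intro s
      constructor
      · intro h
        refine upi fun i => ?_
        have := h i
        rw [hD₁w i, unitNormMap_apply, Pi.mul_apply, Units.val_mul, map_mul] at this
        simp only [Pi.mul_apply, Units.val_mul, unitNormMap_apply, hcvec_val]
        linear_combination this
      · intro h i
        have := congrArg (fun f : Fin 3 → Kˣ => ((f i : Kˣ) : K)) h
        simp only [Pi.mul_apply, Units.val_mul, unitNormMap_apply, hcvec_val] at this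
        rw [hD₁w i, unitNormMap_apply, Pi.mul_apply, Units.val_mul, map_mul]
        linear_combination this
    constructor
    · rintro ⟨s, hsSF, hs⟩
      rw [key] at hs
      have hsU := ((mem_fixedUnitStabilizer_iff σ M₀ s).1 hsSF).2.1
      -- valuations pin `a = a₀`
      have ha : a = a₀ := by
        funext i
        have := congrArg (fun f : Fin 3 → Kˣ => Valued.v ((f i : Kˣ) : K)) hs
        simp only [Pi.mul_apply, Units.val_mul, map_mul] at this
        rw [hcvec_val, hcvec_v, v_unitNormMap_zpow hvσ hϖ ϖu hϖu, v_unitNormMap_of_mem_unitTorus hvσ hu,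
          v_unitNormMap_zpow hvσ hϖ ϖu hϖu, hwU'.1 i, hsU i] at this
        simp only [mul_one, WithZero.exp_inj] at this
        omega
      subst ha
      refine ⟨rfl, ?_⟩
      have hs2 : cvec e * unitNormMap σ 3 u = w * s := mul_left_cancel hs
      rw [hs2, mul_inv_cancel_comm]
      exact hsSF
    · rintro ⟨rfl, hmem⟩
      refine ⟨cvec e * unitNormMap σ 3 u * w⁻¹, hmem, ?_⟩
      rw [key, mul_inv_cancel_comm_assoc]
  -- Step 3: the condition is constant along the `S̃`-coset of `u`
  have step3 : ∀ u ∈ unitTorus K 3, ∀ u' ∈ unitTorus K 3, mapGL (diagGLUnits u) M₀ = mapGL (diagGLUnits u') M₀ →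
      ∀ e : Fin 3 → Bool, cvec e * unitNormMap σ 3 u * w⁻¹ ∈ fixedUnitStabilizer σ M₀ →
        cvec e * unitNormMap σ 3 u' * w⁻¹ ∈ fixedUnitStabilizer σ M₀ := by
    intro u hu u' hu' heq e h
    have hst : u⁻¹ * u' ∈ latticeStabilizer M₀ ⊓ unitTorus K 3 := by
      refine Subgroup.mem_inf.2 ⟨?_, (unitTorus K 3).mul_mem ((unitTorus K 3).inv_mem hu) hu'⟩
      rw [mem_latticeStabilizer_iff, map_mul, mapGL_mul, ← heq, ← mapGL_mul, ← map_mul, inv_mul_cancel, map_one, mapGL_one]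
    have hn : unitNormMap σ 3 (u⁻¹ * u') ∈ fixedUnitStabilizer σ M₀ := hNS (Subgroup.mem_map_of_mem _ hst)
    have hid : cvec e * unitNormMap σ 3 u' * w⁻¹ = (cvec e * unitNormMap σ 3 u * w⁻¹) * unitNormMap σ 3 (u⁻¹ * u') := by
      rw [map_mul, map_inv]
      refine upi fun i => ?_
      simp only [Pi.mul_apply, Pi.inv_apply, Units.val_mul, Units.val_inv_eq_inv_val]
      field_simp
    rw [hid]
    exact (fixedUnitStabilizer σ M₀).mul_mem h hn
  -- Step 4: the double count.  `B e` = the lattices of the orbit counted at sign `e`.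
  set Orb : Set (Submodule 𝒪[K] (Fin 3 → K)) := {M | ∃ u ∈ unitTorus K 3, M = mapGL (diagGLUnits u) M₀} with hOrb
  set Fib : Submodule 𝒪[K] (Fin 3 → K) → Set ((Fin 3 → Bool) × (Fin 3 → ℤ)) := fun M =>
    {p | IsVertexLattice σ ϖ (Matrix.diagonal fun i => if p.1 i then c else (1 : K)) tv (mapGL (diagGLUnits fun i => ϖu ^ p.2 i) M)} with hFib
  set B : (Fin 3 → Bool) → Set (Submodule 𝒪[K] (Fin 3 → K)) := fun e =>
    {M | ∃ u ∈ unitTorus K 3, M = mapGL (diagGLUnits u) M₀ ∧ cvec e * unitNormMap σ 3 u * w⁻¹ ∈ fixedUnitStabilizer σ M₀} with hB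
  have hBsub : ∀ e, B e ⊆ Orb := by
    rintro e M ⟨u, hu, rfl, -⟩; exact ⟨u, hu, rfl⟩
  -- the fibre over an orbit member
  have hFibOrb : ∀ u ∈ unitTorus K 3, ∀ p : (Fin 3 → Bool) × (Fin 3 → ℤ),
      p ∈ Fib (mapGL (diagGLUnits u) M₀) ↔ p.2 = a₀ ∧ mapGL (diagGLUnits u) M₀ ∈ B p.1 := by
    intro u hu p
    rw [show p ∈ Fib (mapGL (diagGLUnits u) M₀) ↔ IsVertexLattice σ ϖ (Matrix.diagonal fun i => if p.1 i then c else (1 : K)) tv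
        (mapGL (diagGLUnits fun i => ϖu ^ p.2 i) (mapGL (diagGLUnits u) M₀)) from Iff.rfl, step2 u hu p.1 p.2]
    constructor
    · rintro ⟨ha, hmem⟩; exact ⟨ha, u, hu, rfl, hmem⟩
    · rintro ⟨ha, u', hu', heq, hmem⟩
      exact ⟨ha, step3 u' hu' u hu heq.symm p.1 hmem⟩
  have hFibfin : ∀ M ∈ Orb, (Fib M).Finite := by
    rintro M ⟨u, hu, rfl⟩
    refine (Set.finite_range (fun e : Fin 3 → Bool => (e, a₀))).subset ?_
    intro p hp
    rw [hFibOrb u hu p] at hp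
    exact ⟨p.1, by rw [← hp.1]⟩
  have hcount : (∑ᶠ M ∈ Orb, (Fib M).ncard) = ∑ e : Fin 3 → Bool, (B e).ncard := by
    rw [← ncard_setOf_mem_and_mem_eq_finsum_mem hfin Fib hFibfin,
      ← ncard_setOf_mem_eq_sum B (fun e => hfin.subset (hBsub e))]
    -- the bijection `(e, M) ↦ (M, (e, a₀))`
    have hinj : Function.Injective (fun q : (Fin 3 → Bool) × Submodule 𝒪[K] (Fin 3 → K) => (q.2, (q.1, a₀))) := by
      rintro ⟨e, M⟩ ⟨e', M'⟩ h
      simp only [Prod.mk.injEq] at h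
      obtain ⟨rfl, rfl, -⟩ := h
      rfl
    rw [← Set.ncard_image_of_injective _ hinj]
    congr 1
    ext ⟨M, p⟩
    constructor
    · rintro ⟨⟨u, hu, hMu⟩, hp⟩
      dsimp only at hMu hp
      subst hMu
      rw [hFibOrb u hu] at hp
      refine ⟨⟨p.1, mapGL (diagGLUnits u) M₀⟩, ?_, ?_⟩
      · show mapGL (diagGLUnits u) M₀ ∈ B p.1
        exact hp.2
      · exact Prod.ext rfl (Prod.ext rfl hp.1.symm)
    · rintro ⟨⟨e, M'⟩, hM', hq⟩
      have hM'B : M' ∈ B e := hM'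
      have h1 : M' = M := congrArg Prod.fst hq
      have h2 : (e, a₀) = p := congrArg Prod.snd hq
      subst h1; subst h2
      obtain ⟨u, hu, hMu, hmem⟩ := hM'B
      subst hMu
      refine ⟨⟨u, hu, rfl⟩, ?_⟩
      show (e, a₀) ∈ Fib (mapGL (diagGLUnits u) M₀)
      rw [hFibOrb u hu]
      exact ⟨rfl, u, hu, rfl, hmem⟩
  -- Step 5: for each `e`, `B e` is empty or ONE translate of the `H`-orbit, `H = 𝒯 ∩ N⁻¹(S_F)`
  set H : Subgroup (Fin 3 → Kˣ) := unitTorus K 3 ⊓ (latticeStabilizer M₀ ⊓ fixedUnitTorus σ 3).comap (unitNormMap σ 3) with hH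
  have hBcount : ∀ e, (B e).ncard =
      if (∃ u₀ ∈ unitTorus K 3, cvec e * unitNormMap σ 3 u₀ * w⁻¹ ∈ fixedUnitStabilizer σ M₀) then (latticeStabilizer M₀).relIndex H else 0 := by
    intro e
    split_ifs with hgood
    · obtain ⟨u₀, hu₀, h₀⟩ := hgood
      have hBe : B e = {M | ∃ h ∈ H, M = mapGL (diagGLUnits (u₀ * h)) M₀} := by
        ext M
        simp only [Set.mem_setOf_eq]
        constructor
        · rintro ⟨u, hu, rfl, h⟩
          refine ⟨u₀⁻¹ * u, ?_, by rw [mul_inv_cancel_left]⟩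
          rw [hH]
          refine Subgroup.mem_inf.2 ⟨(unitTorus K 3).mul_mem ((unitTorus K 3).inv_mem hu₀) hu, ?_⟩
          rw [Subgroup.mem_comap]
          have hid : unitNormMap σ 3 (u₀⁻¹ * u) = (cvec e * unitNormMap σ 3 u₀ * w⁻¹)⁻¹ * (cvec e * unitNormMap σ 3 u * w⁻¹) := by
            rw [map_mul, map_inv]
            refine upi fun i => ?_
            simp only [Pi.mul_apply, Pi.inv_apply, Units.val_mul, Units.val_inv_eq_inv_val]
            field_simp
          rw [hid]
          exact (fixedUnitStabilizer σ M₀).mul_mem ((fixedUnitStabilizer σ M₀).inv_mem h₀) h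
        · rintro ⟨h, hh, rfl⟩
          rw [hH] at hh
          obtain ⟨hhT, hhN⟩ := Subgroup.mem_inf.1 hh
          rw [Subgroup.mem_comap] at hhN
          refine ⟨u₀ * h, (unitTorus K 3).mul_mem hu₀ hhT, rfl, ?_⟩
          have hid : cvec e * unitNormMap σ 3 (u₀ * h) * w⁻¹ = (cvec e * unitNormMap σ 3 u₀ * w⁻¹) * unitNormMap σ 3 h := by
            rw [map_mul]
            refine upi fun i => ?_
            simp only [Pi.mul_apply, Pi.inv_apply, Units.val_mul, Units.val_inv_eq_inv_val]
            field_simp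
          rw [hid]
          exact (fixedUnitStabilizer σ M₀).mul_mem h₀ hhN
      rw [hBe, ncard_translate_subgroup_orbit_eq_relIndex]
    · have hBe : B e = ∅ := by
        ext M
        simp only [Set.mem_empty_iff_false, iff_false]
        rintro ⟨u, hu, -, h⟩
        exact hgood ⟨u, hu, h⟩
      rw [hBe, Set.ncard_empty]
  -- Step 6: which `e` occur: `∃ u₀` iff `w⁻¹·c^e ∈ N(𝒯) ⊔ S_F`
  have hgood_iff : ∀ e, (∃ u₀ ∈ unitTorus K 3, cvec e * unitNormMap σ 3 u₀ * w⁻¹ ∈ fixedUnitStabilizer σ M₀) ↔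
      w⁻¹ * cvec e ∈ (unitTorus K 3).map (unitNormMap σ 3) ⊔ latticeStabilizer M₀ ⊓ fixedUnitTorus σ 3 := by
    intro e
    constructor
    · rintro ⟨u₀, hu₀, h⟩
      have hid : w⁻¹ * cvec e = unitNormMap σ 3 u₀⁻¹ * (cvec e * unitNormMap σ 3 u₀ * w⁻¹) := by
        rw [map_inv]
        refine upi fun i => ?_
        simp only [Pi.mul_apply, Pi.inv_apply, Units.val_mul, Units.val_inv_eq_inv_val]
        field_simp
      rw [hid]
      exact Subgroup.mul_mem _ (Subgroup.mem_sup_left (Subgroup.mem_map_of_mem _ ((unitTorus K 3).inv_mem hu₀))) (Subgroup.mem_sup_right h)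
    · intro h
      obtain ⟨y, hy, z, hz, hyz⟩ := Subgroup.mem_sup.1 h
      obtain ⟨t, ht, rfl⟩ := hy
      refine ⟨t⁻¹, (unitTorus K 3).inv_mem ht, ?_⟩
      have hid : cvec e * unitNormMap σ 3 t⁻¹ * w⁻¹ = (unitNormMap σ 3 t)⁻¹ * (w⁻¹ * cvec e) := by
        rw [map_inv]
        refine upi fun i => ?_
        simp only [Pi.mul_apply, Pi.inv_apply, Units.val_mul, Units.val_inv_eq_inv_val]
        field_simp
      rw [hid, ← hyz, inv_mul_cancel_left]
      exact hz
  -- Step 7: the representatives count (PART 1) — `#{e good} = [N𝒯 ⊔ S_F : N𝒯]` and `[𝒰 : N𝒯] = 8`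
  have hrep : ∀ x ∈ fixedUnitTorus σ 3, ∃! e : Fin 3 → Bool, x * (cvec e)⁻¹ ∈ (unitTorus K 3).map (unitNormMap σ 3) :=
    fun x hx => existsUnique_signVector_mem_map_unitNormMap hvσ hσc hcv hc hdich cU hcU x hx
  have hXU : (unitTorus K 3).map (unitNormMap σ 3) ⊔ latticeStabilizer M₀ ⊓ fixedUnitTorus σ 3 ≤ fixedUnitTorus σ 3 :=
    sup_le hNT inf_le_right
  have hgood_card : (Finset.univ.filter fun e : Fin 3 → Bool =>
        ∃ u₀ ∈ unitTorus K 3, cvec e * unitNormMap σ 3 u₀ * w⁻¹ ∈ fixedUnitStabilizer σ M₀).card =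
      ((unitTorus K 3).map (unitNormMap σ 3)).relIndex ((unitTorus K 3).map (unitNormMap σ 3) ⊔ latticeStabilizer M₀ ⊓ fixedUnitTorus σ 3) := by
    rw [← card_filter_mem_coset_eq_relIndex ((unitTorus K 3).map (unitNormMap σ 3)) _ (fixedUnitTorus σ 3) le_sup_left hXU cvec hcvecU hrep w hwU]
    congr 1
    ext e
    simp only [Finset.mem_filter, Finset.mem_univ, true_and]
    exact hgood_iff e
  have h8 : ((unitTorus K 3).map (unitNormMap σ 3)).relIndex (fixedUnitTorus σ 3) = 8 := by
    rw [← card_filter_mem_coset_eq_relIndex ((unitTorus K 3).map (unitNormMap σ 3)) (fixedUnitTorus σ 3) (fixedUnitTorus σ 3) hNT le_rfl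
      cvec hcvecU hrep 1 (Subgroup.one_mem _)]
    rw [Finset.filter_true_of_mem (fun e _ => by rw [inv_one, one_mul]; exact hcvecU e)]
    simp
  -- Step 8: assemble
  have htotal : (∑ᶠ M ∈ Orb, (Fib M).ncard) =
      ((unitTorus K 3).map (unitNormMap σ 3)).relIndex ((unitTorus K 3).map (unitNormMap σ 3) ⊔ latticeStabilizer M₀ ⊓ fixedUnitTorus σ 3) *
        (latticeStabilizer M₀).relIndex H := by
    rw [hcount, Finset.sum_congr rfl fun e _ => hBcount e, Finset.sum_ite, Finset.sum_const_zero, add_zero, Finset.sum_const,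
      smul_eq_mul, hgood_card]
  have hSH : (latticeStabilizer M₀).relIndex H = (latticeStabilizer M₀ ⊓ unitTorus K 3).relIndex H := by
    rw [← Subgroup.inf_relIndex_right (latticeStabilizer M₀ ⊓ unitTorus K 3) H, ← Subgroup.inf_relIndex_right (latticeStabilizer M₀) H]
    congr 1
    rw [inf_assoc, inf_eq_right.2 (inf_le_left : H ≤ unitTorus K 3)]
  have hidx := relIndex_map_sup_mul_relIndex_comap_mul_relIndex_eq (unitTorus K 3) (fixedUnitTorus σ 3) (latticeStabilizer M₀)
    (unitNormMap σ 3) hNT hNS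
  rw [h8] at hidx
  change (∑ᶠ M ∈ Orb, (Fib M).ncard) * (latticeStabilizer M₀ ⊓ fixedUnitTorus σ 3).relIndex (fixedUnitTorus σ 3) =
    8 * (latticeStabilizer M₀ ⊓ unitTorus K 3).relIndex (unitTorus K 3)
  rw [htotal, hSH]
  exact hidx

/-! ## §3  The vanishing head -/

/-- **(O2b) — VANISHING HEAD.**  If `M₀` carries NO `σ`-fixed non-degenerate diagonal form of type `tv`, every fibre along its unit-torus orbit is empty (★ K transport), so the
finsum vanishes (no finiteness or coset hypothesis needed). [cite: Kottwitz1986BaseChangeUnits, §1 pp. 240–241] -/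
theorem finsum_ncard_fibre_eq_zero_of_not_exists {σ : K →+* K} (hσ : ∀ x, σ (σ x) = x) (ϖ : K) (ϖu : Kˣ)
    {c : K} (hσc : σ c = c) (hc0 : c ≠ 0) {M₀ : Submodule 𝒪[K] (Fin 3 → K)} (tv : ℕ)
    (hne : ¬ ∃ D₁ : Fin 3 → K, (∀ i, σ (D₁ i) = D₁ i ∧ D₁ i ≠ 0) ∧ IsVertexLattice σ ϖ (Matrix.diagonal D₁) tv M₀) :
    (∑ᶠ M ∈ {M : Submodule 𝒪[K] (Fin 3 → K) | ∃ u ∈ unitTorus K 3, M = mapGL (diagGLUnits u) M₀},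
        ({p : (Fin 3 → Bool) × (Fin 3 → ℤ) |
          IsVertexLattice σ ϖ (Matrix.diagonal fun i => if p.1 i then c else (1 : K)) tv (mapGL (diagGLUnits fun i => ϖu ^ p.2 i) M)} : Set _).ncard) = 0 := by
  apply finsum_mem_of_eqOn_zero
  rintro M ⟨u, -, rfl⟩
  change ({p : (Fin 3 → Bool) × (Fin 3 → ℤ) |
      IsVertexLattice σ ϖ (Matrix.diagonal fun i => if p.1 i then c else (1 : K)) tv
        (mapGL (diagGLUnits fun i => ϖu ^ p.2 i) (mapGL (diagGLUnits u) M₀))} : Set _).ncard = 0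
  have hempty : ({p : (Fin 3 → Bool) × (Fin 3 → ℤ) |
      IsVertexLattice σ ϖ (Matrix.diagonal fun i => if p.1 i then c else (1 : K)) tv
        (mapGL (diagGLUnits fun i => ϖu ^ p.2 i) (mapGL (diagGLUnits u) M₀))} : Set _) = ∅ := by
    ext p
    simp only [Set.mem_setOf_eq, Set.mem_empty_iff_false, iff_false]
    intro hp
    rw [← mapGL_mul, ← map_mul, isVertexLattice_diagonal_mapGL_diagGLUnits_iff] at hp
    refine hne ⟨_, fun i => ⟨?_, ?_⟩, hp⟩
    · have hfix : σ (if p.1 i then c else (1 : K)) = if p.1 i then c else 1 := by by_cases h : p.1 i <;> simp [h, hσc]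
      rw [map_mul, map_mul, hfix, hσ, mul_comm (σ _) (_ : K)]
    · have hne' : (if p.1 i then c else (1 : K)) ≠ 0 := by by_cases h : p.1 i <;> simp [h, hc0]
      exact mul_ne_zero hne' (mul_ne_zero (Units.ne_zero _) ((map_ne_zero σ).2 (Units.ne_zero _)))
  rw [hempty, Set.ncard_empty]

end Summit.HodgeConjecture.HodgeConjecture.Cruxes.H413.F0P3cDyRamDiagonalOrbitFibreCount

end
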